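import Summits.BirchSwinnertonDyer.Rank1Residual.Supersingular.RankZeroKimTamDefectRecords
import HarnessLib

/-!
# N6 TAM-DEFECT (X8, `r_an = 0`, `ord₃ ∏c_ℓ = 1`): a SECOND level-`𝒩₂` Kurihara-number RECORD for `9950f1`, at the first
# `109`-free cyclic level `n = 1531·1747 = 2 674 657`, where the number is TWO-ENGINE (iw-2 ENGINE K v1.3 + ENGINE M v1.0, method-independent,
# AGREE) — cell `b2b-bsdres`, supersingular family prover B = unit `b2b-bsdres-additive-p3`, gen 24; class lead N6·O3

HONEST FRAMING (cell `b2b-bsdres-*`, verbatim): prove what is provable now; shrink each hard class to its core with data; no claim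
beyond stated classes; COMBINATION classes deleted from PUBLISHED theorems only, CONSTRUCTION-shaped remainder typed; this is not
"finishing BSD". X8 stays CONSTRUCTION-SHAPED; NOT a class theorem; nothing is booked; N6's mark does not move. The theorem below is
CONDITIONAL on the ANNOUNCED preprint C.-H. Kim (app. R. Pollack), arXiv:2505.09121 Thm. 1.1 (`hK25s`, OPEN binder) + `hW`
(Wuthrich 2014 Prop. 21, PUBLISHED; the cell's R-WU14-P21-SS caveat on its supersingular reading stands as recorded in
`class-closure/N6/STATEMENT.md`) and takes AS A BINDER the non-vanishing of ONE level-`9` Kurihara number at `n = 2 674 657`.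

WHY A SECOND RECORD. Gen 21's `bsdp_x8r0kim9_9950f1` (`RankZeroKimTamDefectRecords.lean`) reads the number at `n = 4 404 187 = 1747·2521`
from ONE engine (cc-eng-6 KURX impl1x); iw-2's ENGINE K v1.3 found `δ⁽²⁾_n ≡ 0 (mod 9)` at all five cyclic `𝒩₂` levels `109·ℓ′` it ran
first (GEN 12), then — GEN 13/14 UP4, kit j142524 (2.9 h; `HOME/code/b2b-bsdres-iw-2/JOBS.md` GEN 14 (A) 04:37Z) — `δ⁽²⁾_n ≡ 3 (mod 9)`,
`ord₃ = 1 = ord₃ ∏c_ℓ` at the first `109`-free cyclic level `n = 1531·1747` (roots g = (2, 2), `a_1531 = −7`, `a_1747 = 11`, D = 1, feq 6.9e-15,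
round_resid 1.5e-11), and ENGINE M v1.0 (numerical modular symbols by the Atkin–Lehner q-expansion identity; kit j148459, 1.7 h, JOBS.md GEN 14
(D) 05:22Z) reads `δ⁽²⁾_n ≡ 3 (mod 9)` at the same level with all three family orbit tables equal as rationals — pre-registered comparison
AGREE (two engines, no shared code path). So this cell now has a level whose datum is two-engine; the record below is that level's.
Both records are EVIDENCE-grade and conditional on the same binders; neither is offered for booking by this seat.

WHAT THE KERNEL DECIDES (shape `X8RankZero.bsdp_three_of_kim2025_OPEN_of_ainvs_of_kuriharaNumber_ne_zero_pair`, gen 21): global minimality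
of the Cremona model (x11c bounded Kraus), `3 ∤ Δ`, class X8 (`#Ẽ(𝔽₃) = 1`), `ℓ ≡ 1 (mod 9)` for `ℓ = 1531, 1747`, the point counts
`#Ẽ(𝔽_1531) = 1539 = 9·171` (`a = −7`), `#Ẽ(𝔽_1747) = 1737 = 9·193` (`a = 11`) in pow form, so `n ∈ 𝒩₂`; cube tests
`Δ^{(ℓ−1)/3} ≡ 884, 1375 ≢ 1` (cyclic `3`-parts); surj(3) = gen 21's certificate `surj_x8r0_9950f1_3`. BINDERS: `hK25s` (OPEN), `hW`,
`hGZK`, `hmod`, `h3per` (PUBLISHED); `D`; `r_an = 0` and `htam : 2 ≤ ord₃ ∏c_ℓ + 1` (Cremona `∏c_ℓ = 6`); `hδ` (two-engine datum).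

References: [Kim2025RefinedTNC] Thm. 1.1, §8.1.2 (ANNOUNCED, OPEN binder); [Wuthrich2014] Lemma 20, Prop. 21; [Kim2022StructureSelmer]
§1.2.2, Thm. 1.10 (1); [SilvermanAEC2009] III.1, VII.1, VII.5; [IrelandRosen1990] Prop. 5.1.2; [Cremona2006] Table 1; [Miller2011LMS] Def. 1.1.
-/

set_option autoImplicit false

noncomputable section

open scoped Classical MatrixGroups ModularForm

open CongruenceSubgroup WeierstrassCurve Literature.NumberTheory.EllipticCurves
  Literature.NumberTheory.EllipticCurves.ModularForms
  Literature.NumberTheory.EllipticCurves.Rank1Residual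
  Literature.NumberTheory.EllipticCurves.Rank1Residual.Typed
  Literature.NumberTheory.EllipticCurves.Rank1Residual.X11RankOneCertificates
  Literature.NumberTheory.EllipticCurves.Wuthrich2014
  Summit.BirchSwinnertonDyer.BirchSwinnertonDyer.Rank1Residual.IntModel
  Summit.BirchSwinnertonDyer.BirchSwinnertonDyer.Rank1Residual.X11RankOne
  Summit.BirchSwinnertonDyer.Rank1Residual.X11b
  Summit.BirchSwinnertonDyer.Rank1Residual.Additive

namespace Summit.BirchSwinnertonDyer.Rank1Residual.Supersingular

/-- **`9950f1`, second level** (N6 TAM-DEFECT: X8 ∧ `r_an = 0` ∧ surj(3), `∏c_ℓ = 6` (`ord₃ = 1`), `#Ш_an = 9`; Cremona model `[1, -1, 0, -787492, -268781584]`, `N = 9950` = 2·5^2·199): `BSD(E,3)` from ONE level-`𝒩₂` Kurihara number at `n = 2674657 = 1531·1747` (the first `109`-free cyclic `𝒩₂` level; the five levels `109·ℓ′` vanish mod 9 on engine K — a datum about `ℓ = 109` for this curve, no inference) — KERNEL: `ℓ ≡ 1 (mod 9)` for both primes, `#Ẽ(𝔽_{1531}) = 1539` (`a = −7`), `#Ẽ(𝔽_{1747})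 = 1737` (`a = 11`), `9 ∣` both counts (so `n ∈ 𝒩₂`), cube tests `Δ^{(ℓ−1)/3} ≡ 884, 1375 ≢ 1` (cyclic `3`-parts), class X8 (`#Ẽ(𝔽₃) = 1`), minimality, surj(3) (`surj_x8r0_9950f1_3`); BINDERS: `htam : 2 ≤ ord₃∏c_ℓ + 1` (Cremona `∏c_ℓ = 6`), `hδ`: TWO ENGINES, method-independent, AGREE — iw-2 ENGINE K v1.3 (`engKq.py` sha256 6e4d76b7…, twisted L-values; UP4 kit j142524: `δ⁽²⁾_n ≡ 3 (mod 9)`, `ord₃ = 1 = ord₃ ∏c_ℓ` = Kim's expected order; families δ_{1531} ≡ δ_{1747} ≡ 0; roots (2, 2); feq 6.9e-15, round_resid 1.5e-11, D = 1) and iw-2 ENGINE M v1.0 (`engM.py` sha256 95b15293…, numerical modular symbols by the Atkin–Lehner q-expansion identity; kit j148459: `δ⁽²⁾_n ≡ 3 (mod 9)`, the three family orbit tables equal to engine K's as rationals, Hecke relations exact, round_resid 5.7e-13, D = 2; `HOME/code/b2b-bsdres-iw-2/JOBS.md` GEN 14 (A) 04:37Z / (D) 05:22Z, `gen14/k81/compare_KM.py`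 AGREE). Non-vanishing mod 9 does not depend on the surjective `ψ_ℓ` (a change multiplies `δ̃_n` by a unit), so `hδ` is stated for an arbitrary `ψ` surjective at both primes. CONDITIONAL on `hK25s` (OPEN) + `hW` (PUBLISHED); `r_an = 0` Cremona. Per pair; NOT a class theorem; nothing booked. With gen 21's `bsdp_x8r0kim9_9950f1` (n = 4 404 187, KURX one engine; engine M at that level = iw-2 j148462, running at filing) this cell has records at two levels. [claim: Kim2025RefinedTNC, status: under-review] [cite: Kim2025RefinedTNC, Thm. 1.1, §8.1.2 (ANNOUNCED, OPEN binder)] [cite: Wuthrich2014, Prop. 21 (p. 400)] [cite: Kim2022StructureSelmer, §1.2.2] [cite: Cremona2006, Table 1 (Cremona label 9950f1)] -/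
theorem bsdp_x8r0kim9_9950f1_n2674657
    (hK25s : Kim2025.thm11_kimShaLength_of_integralPeriod_OPEN) (hW : sha_dvd_analyticSha)
    (hGZK : rank_eq_analyticRank_of_analyticRank_le_one) (hmod : hasEntireLFunction_rat)
    (h3per : realPeriodRat_eq_unit_mul_plusPeriod_three)
    (W : WeierstrassCurve ℚ) (hWeq : W = ⟨1, -1, 0, -787492, -268781584⟩) (hr : W.analyticRank = 0)
    (htam : 2 ≤ padicValNat 3 W.tamagawaProduct + 1)
    {N : ℕ} [NeZero N] (D : ModularParametrizationData W N)
    (ψ : (ℓ : ℕ) → (ZMod ℓ)ˣ →* Multiplicative (ZMod (3 ^ 2)))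
    (hψ : ∀ ℓ ∈ (2674657 : ℕ).primeFactors, Function.Surjective (ψ ℓ))
    (hδ : kuriharaNumber D.f (3 ^ 2) 2674657 ψ ≠ 0) : BSDp W 3 := by
  subst hWeq
  exact X8RankZero.bsdp_three_of_kim2025_OPEN_of_ainvs_of_kuriharaNumber_ne_zero_pair hK25s hW hGZK hmod
    h3per 1 (-1) 0 (-787492) (-268781584)
    (isGloballyMinimal_of_krausCriterion_bounded 1 (-1) 0 (-787492) (-268781584)
      (by decide +kernel) (by decide +kernel) (by decide +kernel))
    (by decide) (n₃ := 1) (by decide +kernel) (by decide) surj_x8r0_9950f1_3 hr D (k := 2) (by norm_num)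
    htam 1531 1747 (by norm_num) (by norm_num) (by norm_num) (by decide) (by decide) (by decide) (by decide)
    (m₁ := 1539) (m₂ := 1737)
    (by haveI : Fact (Nat.Prime 1531) := ⟨by norm_num⟩
        exact natCard_point_eq_of_powForm 1 (-1) 0 (-787492) (-268781584) 1531 (by norm_num) (by decide)
          (by decide +kernel))
    (by haveI : Fact (Nat.Prime 1747) := ⟨by norm_num⟩
        exact natCard_point_eq_of_powForm 1 (-1) 0 (-787492) (-268781584) 1747 (by norm_num) (by decide)
          (by decide +kernel))
    (by decide) (by decide) (by decide +kernel) (by decide +kernel) (by decide +kernel) (by decide +kernel)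
    (hℓ₁ := ⟨by norm_num⟩) (hℓ₂ := ⟨by norm_num⟩) 2674657 (hn0 := ⟨by norm_num⟩) (by norm_num) ψ hψ hδ

end Summit.BirchSwinnertonDyer.Rank1Residual.Supersingular

end
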